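import Literature.Analysis.FluidPDE.PeriodicSwirlMoserStep
import Literature.Analysis.FluidPDE.LeiZhang2011MeanValue
import HarnessLib

/-!
# Lei–Ren–Zhang 2019, Lemma 2.1: the local maximum estimate per period (Moser chain)

Analysis/FluidPDE proofs file (theorems only, no definitions, no named facts), on the discharge
path of the named fact `Literature.Analysis.FluidPDE.leiRenZhang2019_liouville_periodic`
(Z. Lei, X. Ren, Q. S. Zhang, arXiv:1902.11229 = Math. Ann. 383 (2022), Theorem 1.1). Lemma 2.1
(arXiv pp. 5–6): for a nonnegative (Lipschitz) subsolution `Φ` of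
`∂ₜΦ − ΔΦ + (2/r)∂ᵣΦ + b·∇Φ ≤ 0`, periodic in `z` with period `Z₀` and vanishing on the axis,
"`sup_{P_{R/2}} |Φ| ≤ C {R⁻⁴ ∬_{P_R} |Φ|² dx ds}^{1/2}`, where the constant `C` does not depend on
`R`" (`R ≥ 1`), on the periodic cylinders `P_R = D_R × (−R², 0]`, `D_R = {r < R} × [0, Z₀)`; "By
Moser's iteration, we can finally deduce (2.11) … when `R` approaches `0`, our proof will not work."

This file runs the chain, the periodic twin of the tree's `LeiZhang2011MoserLevel` /
`LeiZhang2011MoserChain` / `LeiZhang2011MeanValue` (general convex powers `H_m = w^m`, `m > 2`, and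
the exponent `p₀ = 4` of that chain; the paper's `H(Φ) = Φ²`):

* `reverse_holder_between_periodCylinders` — one level: the analytic core
  `reverse_holder_step_periodic` with the side conditions discharged for the concrete cut-offs
  `cylCutoff r₂ r₁` (`CylindricalCutoff`) and the time cut-off of `LeiZhang2011Cutoff`;
* `eLpNorm_top_periodCylinder_le_of_reverse_holder` — the bookkeeping: reverse Hölder
  inequalities between the period cylinders `Q_k = (−r_k², 0] × ([0,P] × {r ≤ r_k})`,
  `r_k = (ρ/2)(1 + 3^{-k})`, exponents `p_k = 4 (5/3)^k`, imply
  `‖u‖_{L^∞(Q(ρ/2))} ≤ C₀^{5/8} b^{15/16} ‖u‖_{L⁴(Q(ρ))}` (abstract `eLpNorm_top_le_of_moser_chain`);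
* `moser_level_constant_le_periodic` — the constant along the chain is
  `≤ c (1 + ρ/P)^{2/3} ρ^{-10/3} 9^{(5/3)k}`;
* `meanValue_inequality_periodic` — **Lemma 2.1 in the tree's form**:
  `‖w(F)‖_{L^∞(Q(ρ/2))} ≤ C (1 + ρ/P)^{1/4} ρ^{-5/4} ‖w(F)‖_{L⁴(Q(ρ))}` with `C` independent of
  `ρ` and `P` (the volume of `Q(ρ)` per period is `∼ ρ⁴P`, so for `ρ ≥ P` this is the
  dimension-reduced mean value bound of the lemma, uniform in `ρ`; it degenerates as `ρ → 0`).

## References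

* Z. Lei, X. Ren, Q. S. Zhang, arXiv:1902.11229, §2, Lemma 2.1 and its proof, (2.2)–(2.11)
  (arXiv pp. 5–6). [LeiRenZhang2019]
* Z. Lei, Q. S. Zhang, J. Funct. Anal. 261 (2011) = arXiv:1011.5066, §2 (2.5)–(2.6) (the scheme;
  tree `LeiZhang2011MoserChain`, `LeiZhang2011MeanValue`). [LeiZhang2011]
-/

noncomputable section

open MeasureTheory Set Function Filter Metric intervalIntegral
open _root_.Topology
open scoped InnerProductSpace RealInnerProductSpace NNReal ENNReal Laplacian

namespace Literature.Analysis.FluidPDE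

namespace LeiRenZhang2019

open LeiZhang2011 Literature.Analysis.FunctionSpaces

/-! ### Plumbing -/

/-- The closed period box `[0, L] × {r ≤ ρ}` is compact. [folklore] -/
private theorem isCompact_box_pmv (L ρ : ℝ) :
    IsCompact {x : EuclideanSpace ℝ (Fin 3) | x 2 ∈ Icc 0 L ∧ cylRadius x ≤ ρ} := by
  have hx2 : Continuous fun x : EuclideanSpace ℝ (Fin 3) => x 2 :=
    (EuclideanSpace.proj (𝕜 := ℝ) (2 : Fin 3)).continuous
  refine Metric.isCompact_of_isClosed_isBounded ?_ ?_
  · exact (isClosed_Icc.preimage hx2).inter (isClosed_le continuous_cylRadius continuous_const)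
  · refine (Metric.isBounded_closedBall (x := (0 : EuclideanSpace ℝ (Fin 3))) (r := ρ + |L|)).subset
      fun x hx => ?_
    rw [mem_closedBall_zero_iff]
    have h := norm_le_cylRadius_add_abs_apply_two x
    have h2 : |x 2| ≤ |L| := by
      rw [abs_le]
      exact ⟨by linarith [hx.1.1, abs_nonneg L], hx.1.2.trans (le_abs_self L)⟩
    linarith [hx.2]

/-- A nonnegative cut-off has zero gradient where it vanishes. [folklore] -/
private theorem gradient_eq_zero_of_nonneg_eq_zero_pmv {ψ : EuclideanSpace ℝ (Fin 3) → ℝ}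
    (hψ0 : ∀ y, 0 ≤ ψ y) {x : EuclideanSpace ℝ (Fin 3)} (hx : ψ x = 0) : gradient ψ x = 0 := by
  have hmin : IsLocalMin ψ x := Filter.Eventually.of_forall fun y => by rw [hx]; exact hψ0 y
  rw [gradient, hmin.fderiv_eq_zero, map_zero]

/-- The slab functional of a jointly continuous integrand times a factor vanishing off the
cylinder `{r < ρ}` is continuous in time. [folklore] -/
private theorem continuous_setIntegral_zSlab_pmv {P ρ : ℝ} {f : ℝ → EuclideanSpace ℝ (Fin 3) → ℝ}
    (hf : Continuous fun p : ℝ × EuclideanSpace ℝ (Fin 3) => f p.1 p.2)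
    (hf0 : ∀ s x, ρ ≤ cylRadius x → f s x = 0) :
    Continuous fun s => ∫ x in zSlab P 0, f s x := by
  have h := continuous_parametric_integral_of_continuous
    (μ := (volume : Measure (EuclideanSpace ℝ (Fin 3)))) (f := f) hf (isCompact_box_pmv P ρ)
  refine h.congr fun s => ?_
  exact (setIntegral_zSlab_eq_periodBox (hf0 s)).symm

/-! ### One level of the chain -/

/-- **One Moser step between two period cylinders, side conditions discharged** (Lei–Ren–Zhang
2019, proof of Lemma 2.1, (2.2)–(2.10)). In the setting at radius `ρ` (axisymmetric periodic
`F(s,·) ∈ C²` vanishing on the axis, jointly continuous with `∇F`; the `C¹` divergence-free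
periodic drift with its angular-stream potential, `|Φ| ≤ C_Φ r`; the time-integrated equation on
`[−ρ², 0]` with `N` jointly measurable and integrable on `(−ρ², 0] × ([0, 2P] × {r ≤ ρ})`), for a
convex `H ∈ C²` with `H(0) = 0`, `H'² ≤ κHH″`, `κ ≥ 1`, a `C¹` square root `s_H`, and radii
`0 < r₂ < r₁ ≤ ρ`: `∬_{(−r₂²,0)×(slab∩{r≤r₂})} H(F)^{5/3} ≤ K · (∬_{(−r₁²,0]×([0,P]×{r≤r₁})} H(F))^{5/3}`
with the constant `K` of `reverse_holder_step_periodic` for the cut-offs `cylCutoff r₂ r₁`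
(`D = C_φ/(r₁ − r₂)`) and the time cut-off of (2.2) (`D′ = C_T/(r₁² − r₂²)`, `T₁ = r₁²`). [cite: LeiRenZhang2019, §2, proof of Lemma 2.1, (2.2)–(2.10) (arXiv pp. 5–6)] -/
theorem reverse_holder_between_periodCylinders
    {P ρ : ℝ} (hP : 0 < P) {Mw : ℕ} {C₀ : ℝ}
    (hSob : ∀ ⦃g : ℝ → EuclideanSpace ℝ (Fin 3) → ℝ⦄ ⦃ν : Measure ℝ⦄ ⦃R₀ : ℝ⦄,
      (∀ᵐ s ∂ν, ContDiff ℝ 1 (g s)) → (∀ᵐ s ∂ν, IsAxiallyPeriodic P (g s)) →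
      (∀ᵐ s ∂ν, ∀ x, R₀ ≤ cylRadius x → g s x = 0) →
      ∀ ⦃Mstar : ℝ≥0∞⦄, (∀ᵐ s ∂ν, ∫⁻ x in zSlab P 0, ‖g s x‖ₑ ^ 2 ≤ Mstar) →
      ∀ ⦃W : ℝ → ℝ≥0∞⦄, AEMeasurable W ν →
      (∀ᵐ s ∂ν, (∫⁻ x in zSlab P 0, ‖fderiv ℝ (g s) x‖ₑ ^ 2) +
          ENNReal.ofReal ((C₀ / (Mw * P)) ^ 2) * ∫⁻ x in zSlab P 0, ‖g s x‖ₑ ^ 2 ≤ W s) →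
      ∫⁻ p, ‖g p.1 p.2‖ₑ ^ (10 / 3 : ℝ) ∂(ν.prod (volume.restrict (zSlab P 0))) ≤
        6 * (Mw : ℝ≥0∞) ^ (2 / 3 : ℝ) *
          (SNormLESNormFDerivOfEqConst ℝ (volume : Measure (EuclideanSpace ℝ (Fin 3))) 2 : ℝ≥0∞) ^ 2 *
          Mstar ^ (2 / 3 : ℝ) * ∫⁻ s, W s ∂ν)
    {F N : ℝ → EuclideanSpace ℝ (Fin 3) → ℝ}
    {b : ℝ → EuclideanSpace ℝ (Fin 3) → EuclideanSpace ℝ (Fin 3)}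
    {Φ : ℝ → EuclideanSpace ℝ (Fin 3) → ℝ}
    (hF2 : ∀ s, ContDiff ℝ 2 (F s)) (hFa : ∀ s, IsAxisymmetricScalar (F s))
    (hF0 : ∀ s x, cylRadius x = 0 → F s x = 0) (hFp : ∀ s, IsAxiallyPeriodic P (F s))
    (hb1 : ∀ s, ContDiff ℝ 1 (b s)) (hbdiv : ∀ s x, VectorCalculus.divergence (b s) x = 0)
    (hbp : ∀ s, IsAxiallyPeriodic P (b s))
    (hΦ1 : ∀ s, ContDiff ℝ 1 (Φ s)) (hΦp : ∀ s, IsAxiallyPeriodic P (Φ s))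
    (hΦz : ∀ s x, fderiv ℝ (Φ s) x eZ = ⟪b s x, horizPart x⟫)
    {CΦ : ℝ} (hCΦ : 0 ≤ CΦ) (hΦb : ∀ s x, |Φ s x| ≤ CΦ * cylRadius x)
    (hN : ∀ s x, N s x =
      (Δ (F s)) x - fderiv ℝ (F s) x (b s x) - 2 / cylRadius x * fderiv ℝ (F s) x (eR x))
    (heq : ∀ᵐ x ∂(volume : Measure (EuclideanSpace ℝ (Fin 3))),
      IntervalIntegrable (fun s => N s x) volume (-ρ ^ 2) 0 ∧
        ∀ s ∈ Icc (-ρ ^ 2) 0, F s x = F (-ρ ^ 2) x + ∫ τ in (-ρ ^ 2)..s, N τ x)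
    (hFc : Continuous fun p : ℝ × EuclideanSpace ℝ (Fin 3) => F p.1 p.2)
    (hF1c : Continuous fun p : ℝ × EuclideanSpace ℝ (Fin 3) => gradient (F p.1) p.2)
    (hNm : AEStronglyMeasurable (fun p : ℝ × EuclideanSpace ℝ (Fin 3) => N p.1 p.2)
      ((volume.restrict (Ioc (-ρ ^ 2) 0)).prod volume))
    (hNi : Integrable (fun p : ℝ × EuclideanSpace ℝ (Fin 3) => N p.1 p.2)
      ((volume.restrict (Ioc (-ρ ^ 2) 0)).prod
        (volume.restrict {x : EuclideanSpace ℝ (Fin 3) | x 2 ∈ Icc 0 (2 * P) ∧ cylRadius x ≤ ρ})))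
    -- the nonlinearity
    {H sH : ℝ → ℝ} (hH : ContDiff ℝ 2 H) (hH00 : H 0 = 0) (hH0 : ∀ v, 0 ≤ H v)
    (hH2 : ∀ v, 0 ≤ deriv (deriv H) v) {κ : ℝ} (hκ1 : 1 ≤ κ)
    (hκ : ∀ v, deriv H v ^ 2 ≤ κ * H v * deriv (deriv H) v)
    (hsH : ContDiff ℝ 1 sH) (hsH2 : ∀ v, sH v ^ 2 = H v)
    (hsH' : ∀ v, 2 * deriv sH v ^ 2 ≤ deriv (deriv H) v)
    -- the absolute constants
    {Cφ : ℝ} (hCφ : ∀ ρ₂ ρ₁ : ℝ, 0 ≤ ρ₂ → ρ₂ < ρ₁ → ∀ x : EuclideanSpace ℝ (Fin 3),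
      ‖gradient (cylCutoff ρ₂ ρ₁) x‖ ≤ Cφ / (ρ₁ - ρ₂))
    {CT : ℝ} (hCT : ∀ t, |deriv Real.smoothTransition t| ≤ CT)
    -- the radii
    {r₁ r₂ : ℝ} (hr₂ : 0 < r₂) (hr : r₂ < r₁) (hr₁ : r₁ ≤ ρ) :
    ∫⁻ p in Ioo (-r₂ ^ 2) 0 ×ˢ (zSlab P 0 ∩ {x | cylRadius x ≤ r₂}),
        ENNReal.ofReal (H (F p.1 p.2)) ^ (5 / 3 : ℝ) ∂((volume : Measure ℝ).prod volume) ≤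
      ENNReal.ofReal (6 * (Mw : ℝ) ^ (2 / 3 : ℝ) *
        (SNormLESNormFDerivOfEqConst ℝ (volume : Measure (EuclideanSpace ℝ (Fin 3))) 2 : ℝ) ^ 2 *
        ((4 * κ * (1 + CΦ ^ 2) * (Cφ / (r₁ - r₂)) ^ 2 + CT / (r₁ ^ 2 - r₂ ^ 2)) ^ (2 / 3 : ℝ) *
          (2 * (4 * κ * (1 + CΦ ^ 2) * (Cφ / (r₁ - r₂)) ^ 2 + CT / (r₁ ^ 2 - r₂ ^ 2)) +
            2 * (Cφ / (r₁ - r₂)) ^ 2 + (C₀ / (Mw * P)) ^ 2))) *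
      (∫⁻ p in Ioc (-r₁ ^ 2) 0 ×ˢ {x : EuclideanSpace ℝ (Fin 3) | x 2 ∈ Icc 0 P ∧ cylRadius x ≤ r₁},
        ENNReal.ofReal (H (F p.1 p.2)) ∂((volume : Measure ℝ).prod volume)) ^ (5 / 3 : ℝ) := by
  -- ### elementary facts on the radii
  have hr₁0 : 0 < r₁ := hr₂.trans hr
  have hT : r₂ ^ 2 < r₁ ^ 2 := by nlinarith
  have hT₂ : 0 < r₂ ^ 2 := by positivity
  have hI : Ioc (-r₁ ^ 2) (0 : ℝ) ⊆ Ioc (-ρ ^ 2) 0 := Ioc_subset_Ioc (by nlinarith) le_rfl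
  -- the two-period support box
  set K : Set (EuclideanSpace ℝ (Fin 3)) := {x | x 2 ∈ Icc 0 (2 * P) ∧ cylRadius x ≤ r₁} with hK
  have hKc : IsCompact K := isCompact_box_pmv (2 * P) r₁
  have hKρ : K ⊆ {x : EuclideanSpace ℝ (Fin 3) | x 2 ∈ Icc 0 (2 * P) ∧ cylRadius x ≤ ρ} :=
    fun x hx => ⟨hx.1, hx.2.trans hr₁⟩
  -- ### the cut-offs
  set ψ : EuclideanSpace ℝ (Fin 3) → ℝ := cylCutoff r₂ r₁ with hψdef
  have hψ : ContDiff ℝ 2 ψ := contDiff_cylCutoff r₂ r₁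
  have hψa : IsAxisymmetricScalar ψ := isAxisymmetricScalar_cylCutoff r₂ r₁
  have hψz : ∀ (x : EuclideanSpace ℝ (Fin 3)) (t : ℝ), ψ (x + t • eZ) = ψ x :=
    cylCutoff_add_smul_eZ r₂ r₁
  have hψ1 : ∀ x, cylRadius x ≤ r₂ → ψ x = 1 := fun x hx => cylCutoff_eq_one hr₂.le hr hx
  have hψ0 : ∀ x, r₁ ≤ cylRadius x → ψ x = 0 := fun x hx => cylCutoff_eq_zero hr₂.le hr hx
  have hψ01 : ∀ x, 0 ≤ ψ x ∧ ψ x ≤ 1 := fun x => ⟨cylCutoff_nonneg _ _ _, cylCutoff_le_one _ _ _⟩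
  have hψr : ∀ x, ψ x * fderiv ℝ ψ x (eR x) ≤ 0 := cylCutoff_mul_fderiv_eR_nonpos hr hr₂.le
  obtain ⟨a, ha, haz, -, hψg⟩ := exists_gradient_cylCutoff_eq_smul_horizPart r₂ r₁
  set D : ℝ := Cφ / (r₁ - r₂) with hD
  have hψD : ∀ x, ‖gradient ψ x‖ ≤ D := fun x => hCφ r₂ r₁ hr₂.le hr x
  have hD0 : 0 ≤ D := (norm_nonneg _).trans (hψD 0)
  obtain ⟨hηC, hη1, hη2, hη01, hηD⟩ := timeCutoff_props (T₁ := r₁ ^ 2) (T₂ := r₂ ^ 2) hT hCT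
  set η : ℝ → ℝ := fun s => Real.smoothTransition ((s + r₁ ^ 2) / (r₁ ^ 2 - r₂ ^ 2)) with hηdef
  set D' : ℝ := CT / (r₁ ^ 2 - r₂ ^ 2) with hD'
  have hD'0 : 0 ≤ D' := (abs_nonneg _).trans (hηD 0)
  have hη0 : η (-r₁ ^ 2) = 0 := by
    simp only [hηdef]; rw [show -r₁ ^ 2 + r₁ ^ 2 = -(r₁ ^ 2) + r₁ ^ 2 by ring]; exact hη1
  -- the window cut-off `φ̃ = ψ ω(x₂)` vanishes off `K`
  have hω0 : ∀ z, z ∉ Icc (0 : ℝ) (2 * P) → periodicWindow P z = 0 := by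
    intro z hz
    by_contra h
    have hm := mem_Ioo_of_periodicWindow_ne_zero hP h
    exact hz ⟨hm.1.le, hm.2.le⟩
  have hφt0K : ∀ x, x ∉ K → ψ x * periodicWindow P (x 2) = 0 := by
    intro x hx
    by_cases h1 : r₁ ≤ cylRadius x
    · rw [hψ0 x h1, zero_mul]
    · have h2 : x 2 ∉ Icc (0 : ℝ) (2 * P) := fun h => hx ⟨h, (not_le.1 h1).le⟩
      rw [hω0 _ h2, mul_zero]
  -- ### bounds for `H(F)`, `H'(F)` on `[−r₁², 0] × K`
  have hHFc : Continuous fun p : ℝ × EuclideanSpace ℝ (Fin 3) => H (F p.1 p.2) := hH.continuous.comp hFc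
  have hH'c : Continuous (deriv H) := hH.continuous_deriv (by norm_num)
  have hH''c : Continuous (deriv (deriv H)) := by
    have h2 : ContDiff ℝ (1 + 1) H := by rw [one_add_one_eq_two]; exact hH
    exact h2.deriv'.continuous_deriv le_rfl
  have hH'Fc : Continuous fun p : ℝ × EuclideanSpace ℝ (Fin 3) => deriv H (F p.1 p.2) := hH'c.comp hFc
  have hcpt : IsCompact (Icc (-r₁ ^ 2) (0 : ℝ) ×ˢ K) := isCompact_Icc.prod hKc
  obtain ⟨CH, hCH⟩ : ∃ C, ∀ p ∈ Icc (-r₁ ^ 2) (0 : ℝ) ×ˢ K, ‖H (F p.1 p.2)‖ ≤ C :=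
    hcpt.exists_bound_of_continuousOn hHFc.continuousOn
  obtain ⟨CH', hCH'⟩ : ∃ C, ∀ p ∈ Icc (-r₁ ^ 2) (0 : ℝ) ×ˢ K, ‖deriv H (F p.1 p.2)‖ ≤ C :=
    hcpt.exists_bound_of_continuousOn hH'Fc.continuousOn
  -- ### restriction of the equation data to `[−r₁², 0]`
  have heq' : ∀ᵐ x ∂(volume : Measure (EuclideanSpace ℝ (Fin 3))),
      IntervalIntegrable (fun s => N s x) volume (-r₁ ^ 2) 0 ∧
        ∀ s ∈ Icc (-r₁ ^ 2) 0, F s x = F (-r₁ ^ 2) x + ∫ τ in (-r₁ ^ 2)..s, N τ x := by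
    filter_upwards [heq] with x hx
    exact integrated_eq_rebase (Fx := fun s => F s x) (Nx := fun s => N s x) (by nlinarith) (by nlinarith)
      hx.1 hx.2
  -- ### the space–time integrability of the tested equation
  have hint : Integrable (fun p : ℝ × EuclideanSpace ℝ (Fin 3) =>
      (deriv H (F p.1 p.2) * N p.1 p.2 * η p.1 + H (F p.1 p.2) * deriv η p.1) *
        (ψ p.2 * periodicWindow P (p.2 2)) ^ 2)
      ((volume.restrict (Ioc (-r₁ ^ 2) 0)).prod volume) := by
    set μ₁ : Measure (ℝ × EuclideanSpace ℝ (Fin 3)) := (volume.restrict (Ioc (-r₁ ^ 2) 0)).prod volume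
      with hμ₁
    have hNm₁ : AEStronglyMeasurable (fun p : ℝ × EuclideanSpace ℝ (Fin 3) => N p.1 p.2) μ₁ :=
      hNm.mono_measure (Measure.prod_mono (Measure.restrict_mono hI le_rfl) le_rfl)
    have hηc : Continuous η := hηC.continuous
    have hη'c : Continuous (deriv η) := hηC.continuous_deriv le_rfl
    have hφtc : Continuous fun x : EuclideanSpace ℝ (Fin 3) => ψ x * periodicWindow P (x 2) :=
      hψ.continuous.mul ((contDiff_periodicWindow P (n := 1)).continuous.comp
        (EuclideanSpace.proj (𝕜 := ℝ) (2 : Fin 3)).continuous)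
    have hfm : AEStronglyMeasurable (fun p : ℝ × EuclideanSpace ℝ (Fin 3) =>
        (deriv H (F p.1 p.2) * N p.1 p.2 * η p.1 + H (F p.1 p.2) * deriv η p.1) *
          (ψ p.2 * periodicWindow P (p.2 2)) ^ 2) μ₁ := by
      refine AEStronglyMeasurable.mul (AEStronglyMeasurable.add ?_ ?_) ?_
      · exact (hH'Fc.aestronglyMeasurable.mul hNm₁).mul (hηc.comp continuous_fst).aestronglyMeasurable
      · exact (hHFc.mul (hη'c.comp continuous_fst)).aestronglyMeasurable
      · exact ((hφtc.comp continuous_snd).pow 2).aestronglyMeasurable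
    -- the dominating function `1_K(x) (C_H' |N| + C_H D')`
    set g : ℝ × EuclideanSpace ℝ (Fin 3) → ℝ := fun p =>
      (univ ×ˢ K : Set (ℝ × EuclideanSpace ℝ (Fin 3))).indicator
        (fun p => CH' * ‖N p.1 p.2‖ + CH * D') p with hg
    have hgi : Integrable g μ₁ := by
      rw [hg, integrable_indicator_iff (MeasurableSet.univ.prod hKc.isClosed.measurableSet)]
      have hres : μ₁.restrict (univ ×ˢ K) = (volume.restrict (Ioc (-r₁ ^ 2) 0)).prod (volume.restrict K) := by
        rw [hμ₁, ← Measure.restrict_univ (μ := volume.restrict (Ioc (-r₁ ^ 2) (0:ℝ))),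
          Measure.prod_restrict, Measure.restrict_univ]
      rw [IntegrableOn, hres]
      have hNi₁ : Integrable (fun p : ℝ × EuclideanSpace ℝ (Fin 3) => N p.1 p.2)
          ((volume.restrict (Ioc (-r₁ ^ 2) 0)).prod (volume.restrict K)) :=
        hNi.mono_measure (Measure.prod_mono (Measure.restrict_mono hI le_rfl) (Measure.restrict_mono hKρ le_rfl))
      haveI : IsFiniteMeasure ((volume.restrict (Ioc (-r₁ ^ 2) (0:ℝ))).prod (volume.restrict K)) := by
        haveI : IsFiniteMeasure (volume.restrict (Ioc (-r₁ ^ 2) (0:ℝ))) := ⟨by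
          rw [Measure.restrict_apply_univ]; exact measure_Ioc_lt_top⟩
        haveI : IsFiniteMeasure ((volume : Measure (EuclideanSpace ℝ (Fin 3))).restrict K) := ⟨by
          rw [Measure.restrict_apply_univ]; exact hKc.measure_lt_top⟩
        infer_instance
      exact (hNi₁.norm.const_mul CH').add (integrable_const _)
    refine hgi.mono' hfm ?_
    have hmem : ∀ᵐ p ∂μ₁, p.1 ∈ Ioc (-r₁ ^ 2) (0 : ℝ) := by
      rw [hμ₁, Measure.restrict_prod_eq_prod_univ]
      filter_upwards [ae_restrict_mem (measurableSet_Ioc.prod MeasurableSet.univ)] with p hp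
      exact hp.1
    filter_upwards [hmem] with p hp
    have h5 : (ψ p.2 * periodicWindow P (p.2 2)) ^ 2 ≤ 1 := by
      have hψ1' := hψ01 p.2
      have hω := periodicWindow_nonneg P (p.2 2)
      have hω1 := periodicWindow_le_one P (p.2 2)
      have hprod : 0 ≤ ψ p.2 * periodicWindow P (p.2 2) := mul_nonneg hψ1'.1 hω
      have hprod1 : ψ p.2 * periodicWindow P (p.2 2) ≤ 1 := by nlinarith
      nlinarith
    by_cases hx : p.2 ∈ K
    · have hpI : p ∈ Icc (-r₁ ^ 2) (0 : ℝ) ×ˢ K := ⟨Ioc_subset_Icc_self hp, hx⟩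
      simp only [hg]
      rw [indicator_of_mem (show p ∈ (univ ×ˢ K : Set _) from ⟨mem_univ _, hx⟩)]
      have h1 : ‖deriv H (F p.1 p.2)‖ ≤ CH' := hCH' p hpI
      have h2 : ‖H (F p.1 p.2)‖ ≤ CH := hCH p hpI
      have h3 : |η p.1| ≤ 1 := by rw [abs_of_nonneg (hη01 p.1).1]; exact (hη01 p.1).2
      have h4 : |deriv η p.1| ≤ D' := hηD p.1
      have hCH0 : 0 ≤ CH := (norm_nonneg _).trans h2
      have hCH'0 : 0 ≤ CH' := (norm_nonneg _).trans h1
      rw [Real.norm_eq_abs, abs_mul, abs_of_nonneg (sq_nonneg (ψ p.2 * periodicWindow P (p.2 2)))]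
      calc |deriv H (F p.1 p.2) * N p.1 p.2 * η p.1 + H (F p.1 p.2) * deriv η p.1| *
            (ψ p.2 * periodicWindow P (p.2 2)) ^ 2
          ≤ (|deriv H (F p.1 p.2)| * |N p.1 p.2| * |η p.1| + |H (F p.1 p.2)| * |deriv η p.1|) * 1 := by
            refine mul_le_mul ((abs_add_le _ _).trans (by rw [abs_mul, abs_mul, abs_mul])) h5 (sq_nonneg _)
              (by positivity)
        _ ≤ CH' * ‖N p.1 p.2‖ + CH * D' := by
            rw [mul_one, Real.norm_eq_abs]
            refine add_le_add ?_ ?_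
            · calc |deriv H (F p.1 p.2)| * |N p.1 p.2| * |η p.1| ≤ CH' * |N p.1 p.2| * 1 := by
                    refine mul_le_mul (mul_le_mul_of_nonneg_right ((Real.norm_eq_abs _).symm.le.trans h1)
                      (abs_nonneg _)) h3 (abs_nonneg _) (by positivity)
                _ = CH' * |N p.1 p.2| := mul_one _
            · exact mul_le_mul ((Real.norm_eq_abs _).symm.le.trans h2) h4 (abs_nonneg _) hCH0
    · rw [hφt0K p.2 hx]
      simp only [hg]
      rw [indicator_of_notMem (show p ∉ (univ ×ˢ K : Set _) from fun h => hx h.2)]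
      simp
  -- ### the slab functionals and their continuity in time
  have hψnn : ∀ y, 0 ≤ ψ y := fun y => (hψ01 y).1
  have hgradψ0 : ∀ x, r₁ ≤ cylRadius x → gradient ψ x = 0 := fun x hx =>
    gradient_eq_zero_of_nonneg_eq_zero_pmv hψnn (hψ0 x hx)
  have hgradψc : Continuous (gradient ψ) := continuous_gradient_of_contDiff (hψ.of_le one_le_two)
  have hGc : Continuous fun s => ∫ x in zSlab P 0,
      deriv (deriv H) (F s x) * ‖gradient (F s) x‖ ^ 2 * ψ x ^ 2 :=
    continuous_setIntegral_zSlab_pmv (ρ := r₁)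
      (((hH''c.comp hFc).mul (hF1c.norm.pow 2)).mul ((hψ.continuous.comp continuous_snd).pow 2))
      (fun s x hx => by simp only [hψ0 x hx]; ring)
  have hMc : Continuous fun s => ∫ x in zSlab P 0, H (F s x) * ψ x ^ 2 :=
    continuous_setIntegral_zSlab_pmv (ρ := r₁) (hHFc.mul ((hψ.continuous.comp continuous_snd).pow 2))
      (fun s x hx => by simp only [hψ0 x hx]; ring)
  have hPc : Continuous fun s => ∫ x in zSlab P 0, H (F s x) * ‖gradient ψ x‖ ^ 2 :=
    continuous_setIntegral_zSlab_pmv (ρ := r₁) (hHFc.mul ((hgradψc.comp continuous_snd).norm.pow 2))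
      (fun s x hx => by simp only [hgradψ0 x hx, norm_zero]; ring)
  -- ### apply the analytic core
  exact reverse_holder_step_periodic hP hSob (r₁ := r₁) (r₂ := r₂) (T₁ := r₁ ^ 2) (T₂ := r₂ ^ 2)
    hT₂ hT hF2 hFa hF0 hFp hb1 hbdiv hbp hΦ1 hΦp hΦz hCΦ hΦb hN heq' hH hH00 hH0 hH2 hκ1 hκ hsH
    hsH2 hsH' hψ hψa hψz hψ1 hψ0 hψ01 hψr (by exact_mod_cast ha 1) haz hψg hψD (η := η) hηC hη0 hη2
    hη01 hηD hint
    (G := fun s => ∫ x in zSlab P 0, deriv (deriv H) (F s x) * ‖gradient (F s) x‖ ^ 2 * ψ x ^ 2)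
    (M := fun s => ∫ x in zSlab P 0, H (F s x) * ψ x ^ 2)
    (Pψ := fun s => ∫ x in zSlab P 0, H (F s x) * ‖gradient ψ x‖ ^ 2)
    (fun s => rfl) (fun s => rfl) (fun s => rfl)
    (hGc.intervalIntegrable _ _) (hMc.intervalIntegrable _ _) (hPc.intervalIntegrable _ _) hHFc

/-! ### The chain bookkeeping -/

/-- **The Moser chain on period cylinders** (Lei–Ren–Zhang 2019, proof of Lemma 2.1, "By
Moser's iteration … (2.11)"): reverse Hölder inequalities between the consecutive period cylinders
`Q_k = (−r_k², 0] × ([0,P] × {r ≤ r_k})`, `r_k = (ρ/2)(1 + 3^{-k})`, with exponents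
`p_k = 4(5/3)^k` and constants `(C₀ b^k)^{5/3}`, imply the mean value bound
`‖u‖_{L^∞(Q(ρ/2))} ≤ C₀^{5/8} b^{15/16} ‖u‖_{L⁴(Q(ρ))}`. [cite: LeiRenZhang2019, §2, proof of Lemma 2.1, (2.10)–(2.11) (arXiv p. 6), the iteration] -/
theorem eLpNorm_top_periodCylinder_le_of_reverse_holder {P : ℝ}
    {u : ℝ × EuclideanSpace ℝ (Fin 3) → ℝ}
    (hu : AEStronglyMeasurable u ((volume : Measure ℝ).prod (volume : Measure (EuclideanSpace ℝ (Fin 3)))))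
    (hu0 : ∀ p, 0 ≤ u p) {ρ : ℝ} (hρ : 0 < ρ) {C₀ b : ℝ≥0} (hC₀ : C₀ ≠ 0) (hb : b ≠ 0)
    (H : ∀ k : ℕ,
      ∫⁻ p in Ioo (-(ρ / 2 * (1 + (1 / 3 : ℝ) ^ (k + 1))) ^ 2) 0 ×ˢ
          (zSlab P 0 ∩ {x | cylRadius x ≤ ρ / 2 * (1 + (1 / 3 : ℝ) ^ (k + 1))}),
          ENNReal.ofReal (u p) ^ (4 * (5 / 3 : ℝ) ^ (k + 1)) ∂((volume : Measure ℝ).prod volume) ≤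
        (((C₀ : ℝ≥0∞) * (b : ℝ≥0∞) ^ k) ^ (5 / 3 : ℝ)) *
          (∫⁻ p in Ioc (-(ρ / 2 * (1 + (1 / 3 : ℝ) ^ k)) ^ 2) 0 ×ˢ
              {x : EuclideanSpace ℝ (Fin 3) | x 2 ∈ Icc 0 P ∧ cylRadius x ≤ ρ / 2 * (1 + (1 / 3 : ℝ) ^ k)},
              ENNReal.ofReal (u p) ^ (4 * (5 / 3 : ℝ) ^ k) ∂((volume : Measure ℝ).prod volume)) ^ (5 / 3 : ℝ)) :
    eLpNorm u ∞ (((volume : Measure ℝ).prod (volume : Measure (EuclideanSpace ℝ (Fin 3)))).restrict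
        (Ioc (-(ρ / 2) ^ 2) 0 ×ˢ {x : EuclideanSpace ℝ (Fin 3) | x 2 ∈ Icc 0 P ∧ cylRadius x ≤ ρ / 2})) ≤
      (C₀ : ℝ≥0∞) ^ (5 / 8 : ℝ) * (b : ℝ≥0∞) ^ (15 / 16 : ℝ) *
        eLpNorm u (ENNReal.ofReal 4) (((volume : Measure ℝ).prod
          (volume : Measure (EuclideanSpace ℝ (Fin 3)))).restrict
            (Ioc (-ρ ^ 2) 0 ×ˢ {x : EuclideanSpace ℝ (Fin 3) | x 2 ∈ Icc 0 P ∧ cylRadius x ≤ ρ})) := by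
  set μ : Measure (ℝ × EuclideanSpace ℝ (Fin 3)) := (volume : Measure ℝ).prod volume with hμ
  obtain ⟨r, hr⟩ : ∃ r : ℕ → ℝ, ∀ k, r k = ρ / 2 * (1 + (1 / 3 : ℝ) ^ k) := ⟨_, fun _ => rfl⟩
  have hrb : ∀ k, 0 < r k ∧ ρ / 2 ≤ r k ∧ r k ≤ ρ := fun k => by rw [hr k]; exact moser_radius_bounds hρ k
  set A : ℕ → Set (ℝ × EuclideanSpace ℝ (Fin 3)) := fun k =>
    Ioc (-(r k) ^ 2) 0 ×ˢ {x : EuclideanSpace ℝ (Fin 3) | x 2 ∈ Icc 0 P ∧ cylRadius x ≤ r k} with hA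
  have hp : ∀ k : ℕ, (0 : ℝ) < 4 * (5 / 3 : ℝ) ^ k := fun k => by positivity
  -- the interior period cylinder of level `k+1` is a.e. equal to `A (k+1)`
  have hae : ∀ k, (Ioo (-(r (k + 1)) ^ 2) 0 ×ˢ (zSlab P 0 ∩ {x | cylRadius x ≤ r (k + 1)}) :
      Set (ℝ × EuclideanSpace ℝ (Fin 3))) =ᵐ[μ] A (k + 1) := fun k =>
    Measure.set_prod_ae_eq (Ioo_ae_eq_Ioc (μ := (volume : Measure ℝ)))
      (zSlab_inter_cylinder_ae_eq_periodBox P (r (k + 1)))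
  have hnorm : ∀ (k : ℕ) (S : Set (ℝ × EuclideanSpace ℝ (Fin 3))),
      eLpNorm u (ENNReal.ofReal (4 * (5 / 3 : ℝ) ^ k)) (μ.restrict S) =
        (∫⁻ p in S, ENNReal.ofReal (u p) ^ (4 * (5 / 3 : ℝ) ^ k) ∂μ) ^ (1 / (4 * (5 / 3 : ℝ) ^ k)) := by
    intro k S
    rw [eLpNorm_eq_lintegral_rpow_enorm_toReal (ENNReal.ofReal_pos.2 (hp k)).ne' ENNReal.ofReal_ne_top,
      ENNReal.toReal_ofReal (hp k).le]
    congr 1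
    refine lintegral_congr fun p => ?_
    rw [Real.enorm_eq_ofReal (hu0 p)]
  have Hchain : ∀ k : ℕ, eLpNorm u (ENNReal.ofReal (4 * (5 / 3 : ℝ) ^ (k + 1))) (μ.restrict (A (k + 1))) ≤
      ((C₀ : ℝ≥0∞) * (b : ℝ≥0∞) ^ k) ^ (1 / (4 * (5 / 3 : ℝ) ^ k)) *
        eLpNorm u (ENNReal.ofReal (4 * (5 / 3 : ℝ) ^ k)) (μ.restrict (A k)) := by
    intro k
    have h := H k
    simp only [← hr] at h
    rw [hnorm, hnorm, ← Measure.restrict_congr_set (hae k)]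
    have hpk1 : 0 < 1 / (4 * (5 / 3 : ℝ) ^ (k + 1)) := by positivity
    calc (∫⁻ p in Ioo (-(r (k + 1)) ^ 2) 0 ×ˢ (zSlab P 0 ∩ {x | cylRadius x ≤ r (k + 1)}),
          ENNReal.ofReal (u p) ^ (4 * (5 / 3 : ℝ) ^ (k + 1)) ∂μ) ^ (1 / (4 * (5 / 3 : ℝ) ^ (k + 1)))
        ≤ ((((C₀ : ℝ≥0∞) * (b : ℝ≥0∞) ^ k) ^ (5 / 3 : ℝ)) *
            (∫⁻ p in A k, ENNReal.ofReal (u p) ^ (4 * (5 / 3 : ℝ) ^ k) ∂μ) ^ (5 / 3 : ℝ)) ^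
              (1 / (4 * (5 / 3 : ℝ) ^ (k + 1))) := ENNReal.rpow_le_rpow h hpk1.le
      _ = ((C₀ : ℝ≥0∞) * (b : ℝ≥0∞) ^ k) ^ (1 / (4 * (5 / 3 : ℝ) ^ k)) *
            (∫⁻ p in A k, ENNReal.ofReal (u p) ^ (4 * (5 / 3 : ℝ) ^ k) ∂μ) ^ (1 / (4 * (5 / 3 : ℝ) ^ k)) := by
          rw [ENNReal.mul_rpow_of_nonneg _ _ hpk1.le, ← ENNReal.rpow_mul, ← ENNReal.rpow_mul]
          congr 2 <;> · rw [pow_succ]; field_simp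
  have hchain := eLpNorm_top_le_of_moser_chain (μ := μ) hu (A := A) (p₀ := 4) (χ := 5 / 3)
    (by norm_num) (by norm_num) hC₀ hb Hchain
  have hA0 : A 0 = Ioc (-ρ ^ 2) 0 ×ˢ {x : EuclideanSpace ℝ (Fin 3) | x 2 ∈ Icc 0 P ∧ cylRadius x ≤ ρ} := by
    simp only [hA, hr, pow_zero]; norm_num
  have hsub : Ioc (-(ρ / 2) ^ 2) 0 ×ˢ {x : EuclideanSpace ℝ (Fin 3) | x 2 ∈ Icc 0 P ∧ cylRadius x ≤ ρ / 2} ⊆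
      ⋂ k, A k := by
    refine subset_iInter fun k => prod_mono (Ioc_subset_Ioc ?_ le_rfl) fun x hx => ⟨hx.1, hx.2.trans (hrb k).2.1⟩
    have := (hrb k).2.1
    nlinarith [hρ]
  calc eLpNorm u ∞ (μ.restrict (Ioc (-(ρ / 2) ^ 2) 0 ×ˢ
        {x : EuclideanSpace ℝ (Fin 3) | x 2 ∈ Icc 0 P ∧ cylRadius x ≤ ρ / 2}))
      ≤ eLpNorm u ∞ (μ.restrict (⋂ k, A k)) := eLpNorm_mono_measure u (Measure.restrict_mono hsub le_rfl)
    _ ≤ (C₀ : ℝ≥0∞) ^ ((5 / 3 : ℝ) / (4 * (5 / 3 - 1))) * (b : ℝ≥0∞) ^ ((5 / 3 : ℝ) / (4 * (5 / 3 - 1) ^ 2)) *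
          eLpNorm u (ENNReal.ofReal 4) (μ.restrict (A 0)) := hchain
    _ = (C₀ : ℝ≥0∞) ^ (5 / 8 : ℝ) * (b : ℝ≥0∞) ^ (15 / 16 : ℝ) *
          eLpNorm u (ENNReal.ofReal 4) (μ.restrict (Ioc (-ρ ^ 2) 0 ×ˢ
            {x : EuclideanSpace ℝ (Fin 3) | x 2 ∈ Icc 0 P ∧ cylRadius x ≤ ρ})) := by
        rw [hA0]; norm_num

/-! ### The constant along the chain -/

/-- **The constant of the periodic Moser step along the chain of radii.** With
`r₁ = (ρ/2)(1 + 3^{-k})`, `r₂ = (ρ/2)(1 + 3^{-(k+1)})`, `1 ≤ κ ≤ 2`, cut-off constants `C_φ`,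
`C_T ≥ 0`, `C_Φ`, Sobolev data `C_S`, `C₀` and a number of periods `M ≥ 1` with `ρ ≤ MP`,
`M ≤ 1 + ρ/P`, the constant of `reverse_holder_step_periodic` is at most
`c (1 + ρ/P)^{2/3} ρ^{-10/3} 9^{(5/3)k}` with
`c = 6 C_S² a₁^{2/3} a₂`, `a₁ = 72(1 + C_Φ²)C_φ² + 3C_T`, `a₂ = 2a₁ + 18C_φ² + C₀²` — the
"dimension reduction effect" of Lemma 2.1: the constant of the normalised iteration stays bounded as
`ρ → ∞` for fixed period. [cite: LeiRenZhang2019, §2, proof of Lemma 2.1, (2.10)–(2.11) (arXiv p. 6), the constants of the iteration] -/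
theorem moser_level_constant_le_periodic (k : ℕ) {ρ P : ℝ} (hρ : 0 < ρ) (hP : 0 < P)
    {CS Cφ CT CΦ C₀ κ Mr r₁ r₂ : ℝ} (hCT : 0 ≤ CT) (hκ0 : 0 ≤ κ) (hκ2 : κ ≤ 2)
    (hMr1 : ρ ≤ Mr * P) (hMr2 : Mr ≤ 1 + ρ / P) (hMr0 : 0 < Mr)
    (hr₁ : r₁ = ρ / 2 * (1 + (1 / 3 : ℝ) ^ k)) (hr₂ : r₂ = ρ / 2 * (1 + (1 / 3 : ℝ) ^ (k + 1))) :
    6 * Mr ^ (2 / 3 : ℝ) * CS ^ 2 *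
        ((4 * κ * (1 + CΦ ^ 2) * (Cφ / (r₁ - r₂)) ^ 2 + CT / (r₁ ^ 2 - r₂ ^ 2)) ^ (2 / 3 : ℝ) *
          (2 * (4 * κ * (1 + CΦ ^ 2) * (Cφ / (r₁ - r₂)) ^ 2 + CT / (r₁ ^ 2 - r₂ ^ 2)) +
            2 * (Cφ / (r₁ - r₂)) ^ 2 + (C₀ / (Mr * P)) ^ 2)) ≤
      (6 * CS ^ 2 * (72 * (1 + CΦ ^ 2) * Cφ ^ 2 + 3 * CT) ^ (2 / 3 : ℝ) *
          (2 * (72 * (1 + CΦ ^ 2) * Cφ ^ 2 + 3 * CT) + 18 * Cφ ^ 2 + C₀ ^ 2)) *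
        (1 + ρ / P) ^ (2 / 3 : ℝ) * ρ ^ (-(10 / 3 : ℝ)) * (9 : ℝ) ^ ((5 / 3 : ℝ) * k) := by
  -- `t = 3^k`, `r₁ − r₂ = ρ/(3t)`
  set t : ℝ := (3 : ℝ) ^ k with ht
  have ht0 : 0 < t := by positivity
  have ht1 : 1 ≤ t := one_le_pow₀ (by norm_num)
  have h13 : (1 / 3 : ℝ) ^ k = t⁻¹ := by rw [ht, ← inv_pow]; norm_num
  have hdiff : r₁ - r₂ = ρ * t⁻¹ / 3 := by
    rw [hr₁, hr₂, pow_succ, h13]; ring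
  have hdiff0 : 0 < r₁ - r₂ := by rw [hdiff]; positivity
  have hr₂0 : 0 < r₂ := by rw [hr₂]; positivity
  have hr₁0 : 0 < r₁ := by rw [hr₁]; positivity
  have hsum : ρ ≤ r₁ + r₂ := by
    rw [hr₁, hr₂]
    have h1 : 0 ≤ (1 / 3 : ℝ) ^ k := by positivity
    have h2 : 0 ≤ (1 / 3 : ℝ) ^ (k + 1) := by positivity
    nlinarith
  have hrr : r₁ ^ 2 - r₂ ^ 2 = (r₁ - r₂) * (r₁ + r₂) := by ring
  have hrr0 : 0 < r₁ ^ 2 - r₂ ^ 2 := by rw [hrr]; exact mul_pos hdiff0 (by linarith)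
  -- `D² = 9 C_φ² t²/ρ²`
  have hD2 : (Cφ / (r₁ - r₂)) ^ 2 = 9 * Cφ ^ 2 * t ^ 2 / ρ ^ 2 := by
    rw [hdiff]; field_simp; ring
  -- `D' ≤ 3 C_T t²/ρ²`
  have hD' : CT / (r₁ ^ 2 - r₂ ^ 2) ≤ 3 * CT * t ^ 2 / ρ ^ 2 := by
    have hden : ρ ^ 2 * t⁻¹ / 3 ≤ r₁ ^ 2 - r₂ ^ 2 := by
      rw [hrr, hdiff]
      have : 0 ≤ ρ * t⁻¹ / 3 := by positivity
      nlinarith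
    have hden0 : 0 < ρ ^ 2 * t⁻¹ / 3 := by positivity
    calc CT / (r₁ ^ 2 - r₂ ^ 2) ≤ CT / (ρ ^ 2 * t⁻¹ / 3) := div_le_div_of_nonneg_left hCT hden0 hden
      _ = 3 * CT * t / ρ ^ 2 := by field_simp
      _ ≤ 3 * CT * t ^ 2 / ρ ^ 2 := by
          refine div_le_div_of_nonneg_right ?_ (by positivity)
          nlinarith [mul_nonneg hCT ht0.le]
  -- `c₁ ≤ a₁ t²/ρ²`
  set a₁ : ℝ := 72 * (1 + CΦ ^ 2) * Cφ ^ 2 + 3 * CT with ha₁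
  have ha₁0 : 0 ≤ a₁ := by positivity
  have hc₁ : 4 * κ * (1 + CΦ ^ 2) * (Cφ / (r₁ - r₂)) ^ 2 + CT / (r₁ ^ 2 - r₂ ^ 2) ≤ a₁ * t ^ 2 / ρ ^ 2 := by
    rw [hD2]
    have h1 : 4 * κ * (1 + CΦ ^ 2) * (9 * Cφ ^ 2 * t ^ 2 / ρ ^ 2) ≤
        72 * (1 + CΦ ^ 2) * Cφ ^ 2 * t ^ 2 / ρ ^ 2 := by
      have : 4 * κ ≤ 8 := by linarith
      have h0 : 0 ≤ (1 + CΦ ^ 2) * (9 * Cφ ^ 2 * t ^ 2 / ρ ^ 2) := by positivity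
      calc 4 * κ * (1 + CΦ ^ 2) * (9 * Cφ ^ 2 * t ^ 2 / ρ ^ 2)
          = 4 * κ * ((1 + CΦ ^ 2) * (9 * Cφ ^ 2 * t ^ 2 / ρ ^ 2)) := by ring
        _ ≤ 8 * ((1 + CΦ ^ 2) * (9 * Cφ ^ 2 * t ^ 2 / ρ ^ 2)) := mul_le_mul_of_nonneg_right this h0
        _ = 72 * (1 + CΦ ^ 2) * Cφ ^ 2 * t ^ 2 / ρ ^ 2 := by ring
    calc _ ≤ 72 * (1 + CΦ ^ 2) * Cφ ^ 2 * t ^ 2 / ρ ^ 2 + 3 * CT * t ^ 2 / ρ ^ 2 := add_le_add h1 hD'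
      _ = a₁ * t ^ 2 / ρ ^ 2 := by simp only [ha₁]; ring
  have hc₁0 : 0 ≤ 4 * κ * (1 + CΦ ^ 2) * (Cφ / (r₁ - r₂)) ^ 2 + CT / (r₁ ^ 2 - r₂ ^ 2) :=
    add_nonneg (by positivity) (div_nonneg hCT hrr0.le)
  -- `(C₀/(MP))² ≤ C₀² t²/ρ²`
  have hcw : (C₀ / (Mr * P)) ^ 2 ≤ C₀ ^ 2 * t ^ 2 / ρ ^ 2 := by
    rw [div_pow]
    have hMP : ρ ^ 2 ≤ (Mr * P) ^ 2 := pow_le_pow_left₀ hρ.le hMr1 2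
    have h1 : C₀ ^ 2 / (Mr * P) ^ 2 ≤ C₀ ^ 2 / ρ ^ 2 :=
      div_le_div_of_nonneg_left (sq_nonneg _) (by positivity) hMP
    refine h1.trans ?_
    rw [mul_div_assoc]
    have : C₀ ^ 2 / ρ ^ 2 = C₀ ^ 2 * (1 / ρ ^ 2) := by ring
    rw [this]
    refine mul_le_mul_of_nonneg_left ?_ (sq_nonneg _)
    refine div_le_div_of_nonneg_right ?_ (by positivity)
    nlinarith
  -- `c₂ ≤ a₂ t²/ρ²`
  set a₂ : ℝ := 2 * a₁ + 18 * Cφ ^ 2 + C₀ ^ 2 with ha₂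
  have ha₂0 : 0 ≤ a₂ := by positivity
  have hc₂ : 2 * (4 * κ * (1 + CΦ ^ 2) * (Cφ / (r₁ - r₂)) ^ 2 + CT / (r₁ ^ 2 - r₂ ^ 2)) +
      2 * (Cφ / (r₁ - r₂)) ^ 2 + (C₀ / (Mr * P)) ^ 2 ≤ a₂ * t ^ 2 / ρ ^ 2 := by
    have h2 : 2 * (Cφ / (r₁ - r₂)) ^ 2 = 18 * Cφ ^ 2 * t ^ 2 / ρ ^ 2 := by rw [hD2]; ring
    calc _ ≤ 2 * (a₁ * t ^ 2 / ρ ^ 2) + 18 * Cφ ^ 2 * t ^ 2 / ρ ^ 2 + C₀ ^ 2 * t ^ 2 / ρ ^ 2 := by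
          rw [← h2]; exact add_le_add (add_le_add (mul_le_mul_of_nonneg_left hc₁ zero_le_two) le_rfl) hcw
      _ = a₂ * t ^ 2 / ρ ^ 2 := by simp only [ha₂]; ring
  have hc₂0 : 0 ≤ 2 * (4 * κ * (1 + CΦ ^ 2) * (Cφ / (r₁ - r₂)) ^ 2 + CT / (r₁ ^ 2 - r₂ ^ 2)) +
      2 * (Cφ / (r₁ - r₂)) ^ 2 + (C₀ / (Mr * P)) ^ 2 := by positivity
  -- `M^{2/3} ≤ (1 + ρ/P)^{2/3}`
  have hM23 : Mr ^ (2 / 3 : ℝ) ≤ (1 + ρ / P) ^ (2 / 3 : ℝ) := Real.rpow_le_rpow hMr0.le hMr2 (by norm_num)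
  -- assemble
  have hc₁23 : (4 * κ * (1 + CΦ ^ 2) * (Cφ / (r₁ - r₂)) ^ 2 + CT / (r₁ ^ 2 - r₂ ^ 2)) ^ (2 / 3 : ℝ) ≤
      a₁ ^ (2 / 3 : ℝ) * (t ^ 2 / ρ ^ 2) ^ (2 / 3 : ℝ) := by
    calc _ ≤ (a₁ * t ^ 2 / ρ ^ 2) ^ (2 / 3 : ℝ) := Real.rpow_le_rpow hc₁0 hc₁ (by norm_num)
      _ = a₁ ^ (2 / 3 : ℝ) * (t ^ 2 / ρ ^ 2) ^ (2 / 3 : ℝ) := by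
          rw [mul_div_assoc, Real.mul_rpow ha₁0 (by positivity)]
  have htρ : (t ^ 2 / ρ ^ 2) ^ (2 / 3 : ℝ) * (t ^ 2 / ρ ^ 2) = ρ ^ (-(10 / 3 : ℝ)) * (9 : ℝ) ^ ((5 / 3 : ℝ) * k) := by
    have e1 : (t ^ 2 / ρ ^ 2) ^ (2 / 3 : ℝ) * (t ^ 2 / ρ ^ 2) = (t ^ 2 / ρ ^ 2) ^ (5 / 3 : ℝ) := by
      rw [show (5 / 3 : ℝ) = 2 / 3 + 1 by norm_num, Real.rpow_add (by positivity), Real.rpow_one]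
    rw [e1, Real.div_rpow (by positivity) (by positivity), ← Real.rpow_natCast t 2, ← Real.rpow_natCast ρ 2,
      ← Real.rpow_mul ht0.le, ← Real.rpow_mul hρ.le, ht, ← Real.rpow_natCast (3 : ℝ) k,
      ← Real.rpow_mul (by norm_num), show (9 : ℝ) = 3 ^ (2 : ℝ) by norm_num, ← Real.rpow_mul (by norm_num),
      div_eq_mul_inv, ← Real.rpow_neg hρ.le]
    norm_num
    ring_nf
  calc 6 * Mr ^ (2 / 3 : ℝ) * CS ^ 2 *
        ((4 * κ * (1 + CΦ ^ 2) * (Cφ / (r₁ - r₂)) ^ 2 + CT / (r₁ ^ 2 - r₂ ^ 2)) ^ (2 / 3 : ℝ) *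
          (2 * (4 * κ * (1 + CΦ ^ 2) * (Cφ / (r₁ - r₂)) ^ 2 + CT / (r₁ ^ 2 - r₂ ^ 2)) +
            2 * (Cφ / (r₁ - r₂)) ^ 2 + (C₀ / (Mr * P)) ^ 2))
      ≤ 6 * (1 + ρ / P) ^ (2 / 3 : ℝ) * CS ^ 2 *
          ((a₁ ^ (2 / 3 : ℝ) * (t ^ 2 / ρ ^ 2) ^ (2 / 3 : ℝ)) * (a₂ * t ^ 2 / ρ ^ 2)) := by
        have h6 : 6 * Mr ^ (2 / 3 : ℝ) * CS ^ 2 ≤ 6 * (1 + ρ / P) ^ (2 / 3 : ℝ) * CS ^ 2 :=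
          mul_le_mul_of_nonneg_right (mul_le_mul_of_nonneg_left hM23 (by norm_num)) (sq_nonneg _)
        have h7 : (4 * κ * (1 + CΦ ^ 2) * (Cφ / (r₁ - r₂)) ^ 2 + CT / (r₁ ^ 2 - r₂ ^ 2)) ^ (2 / 3 : ℝ) *
            (2 * (4 * κ * (1 + CΦ ^ 2) * (Cφ / (r₁ - r₂)) ^ 2 + CT / (r₁ ^ 2 - r₂ ^ 2)) +
              2 * (Cφ / (r₁ - r₂)) ^ 2 + (C₀ / (Mr * P)) ^ 2) ≤
            (a₁ ^ (2 / 3 : ℝ) * (t ^ 2 / ρ ^ 2) ^ (2 / 3 : ℝ)) * (a₂ * t ^ 2 / ρ ^ 2) :=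
          mul_le_mul hc₁23 hc₂ hc₂0 (by positivity)
        calc _ = (6 * Mr ^ (2 / 3 : ℝ) * CS ^ 2) *
              ((4 * κ * (1 + CΦ ^ 2) * (Cφ / (r₁ - r₂)) ^ 2 + CT / (r₁ ^ 2 - r₂ ^ 2)) ^ (2 / 3 : ℝ) *
                (2 * (4 * κ * (1 + CΦ ^ 2) * (Cφ / (r₁ - r₂)) ^ 2 + CT / (r₁ ^ 2 - r₂ ^ 2)) +
                  2 * (Cφ / (r₁ - r₂)) ^ 2 + (C₀ / (Mr * P)) ^ 2)) := by ring
          _ ≤ (6 * (1 + ρ / P) ^ (2 / 3 : ℝ) * CS ^ 2) *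
              ((a₁ ^ (2 / 3 : ℝ) * (t ^ 2 / ρ ^ 2) ^ (2 / 3 : ℝ)) * (a₂ * t ^ 2 / ρ ^ 2)) :=
            mul_le_mul h6 h7 (mul_nonneg (Real.rpow_nonneg hc₁0 _) hc₂0) (by positivity)
    _ = (6 * CS ^ 2 * a₁ ^ (2 / 3 : ℝ) * a₂) * (1 + ρ / P) ^ (2 / 3 : ℝ) *
          ((t ^ 2 / ρ ^ 2) ^ (2 / 3 : ℝ) * (t ^ 2 / ρ ^ 2)) := by ring
    _ = _ := by rw [htρ]; ring

/-! ### Lemma 2.1: the mean value inequality per period -/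

set_option maxHeartbeats 800000 in
/-- **The mean value inequality per period (Lei–Ren–Zhang 2019, Lemma 2.1)** for the swirl-type
equation with a divergence-free `z`-periodic drift. There is a constant `C ≥ 0` such that: for
every period `P > 0` and radius `ρ > 0`, every solution `F` in the setting at radius `ρ`
(hypotheses as in `reverse_holder_between_periodCylinders`: axisymmetric `P`-periodic
`F(s,·) ∈ C²` vanishing on the axis, jointly continuous with `∇F`, the `C¹` divergence-free
`P`-periodic drift `b` with an angular-stream potential `Φ`, `∂_zΦ = ⟪b, x_h⟫`, `|Φ| ≤ C_Φ r`, the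
time-integrated equation on `[−ρ², 0]` with `N` measurable and integrable on
`(−ρ², 0] × ([0,2P] × {r ≤ ρ})`), and every admissible power family `H_m = w^m`, `m > 2`
(`H_m ∈ C²`, `H_m(0) = 0`, `H_m″ ≥ 0`, `H_m'² ≤ (m/(m−1))H_mH_m″`, `C¹` square roots), the
quantity `u = w(F)` satisfies
`‖u‖_{L^∞((−ρ²/4,0]×([0,P]×{r≤ρ/2}))} ≤ C (1 + C_Φ²)^{5/8} (1 + ρ/P)^{1/4} ρ^{-5/4} ‖u‖_{L⁴((−ρ²,0]×([0,P]×{r≤ρ}))}`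
— with `|Q(ρ)| ∼ ρ⁴P` per period this is "`sup_{P_{R/2}}|Φ| ≤ C{R⁻⁴∬_{P_R}|Φ|²}^{1/2}` with `C`
independent of `R ≥ 1`" (period `Z₀ = 1`), here from `L⁴` and for general powers as in the
tree's Lei–Zhang chain. [cite: LeiRenZhang2019, §2, Lemma 2.1 (arXiv p. 5), the local maximum estimate on P_R] -/
theorem meanValue_inequality_periodic :
    ∃ Cmv : ℝ, 0 ≤ Cmv ∧ ∀ ⦃P : ℝ⦄, 0 < P → ∀ ⦃ρ : ℝ⦄, 0 < ρ →
      ∀ ⦃F N : ℝ → EuclideanSpace ℝ (Fin 3) → ℝ⦄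
        ⦃b : ℝ → EuclideanSpace ℝ (Fin 3) → EuclideanSpace ℝ (Fin 3)⦄
        ⦃Φ : ℝ → EuclideanSpace ℝ (Fin 3) → ℝ⦄ ⦃CΦ : ℝ⦄,
      (∀ s, ContDiff ℝ 2 (F s)) → (∀ s, IsAxisymmetricScalar (F s)) →
      (∀ s x, cylRadius x = 0 → F s x = 0) → (∀ s, IsAxiallyPeriodic P (F s)) →
      (∀ s, ContDiff ℝ 1 (b s)) → (∀ s x, VectorCalculus.divergence (b s) x = 0) →
      (∀ s, IsAxiallyPeriodic P (b s)) →
      (∀ s, ContDiff ℝ 1 (Φ s)) → (∀ s, IsAxiallyPeriodic P (Φ s)) →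
      (∀ s x, fderiv ℝ (Φ s) x eZ = ⟪b s x, horizPart x⟫) →
      0 ≤ CΦ → (∀ s x, |Φ s x| ≤ CΦ * cylRadius x) →
      (∀ s x, N s x =
        (Δ (F s)) x - fderiv ℝ (F s) x (b s x) - 2 / cylRadius x * fderiv ℝ (F s) x (eR x)) →
      (∀ᵐ x ∂(volume : Measure (EuclideanSpace ℝ (Fin 3))),
        IntervalIntegrable (fun s => N s x) volume (-ρ ^ 2) 0 ∧
          ∀ s ∈ Icc (-ρ ^ 2) 0, F s x = F (-ρ ^ 2) x + ∫ τ in (-ρ ^ 2)..s, N τ x) →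
      (Continuous fun p : ℝ × EuclideanSpace ℝ (Fin 3) => F p.1 p.2) →
      (Continuous fun p : ℝ × EuclideanSpace ℝ (Fin 3) => gradient (F p.1) p.2) →
      AEStronglyMeasurable (fun p : ℝ × EuclideanSpace ℝ (Fin 3) => N p.1 p.2)
        ((volume.restrict (Ioc (-ρ ^ 2) 0)).prod volume) →
      Integrable (fun p : ℝ × EuclideanSpace ℝ (Fin 3) => N p.1 p.2)
        ((volume.restrict (Ioc (-ρ ^ 2) 0)).prod
          (volume.restrict {x : EuclideanSpace ℝ (Fin 3) | x 2 ∈ Icc 0 (2 * P) ∧ cylRadius x ≤ ρ})) →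
      ∀ ⦃w : ℝ → ℝ⦄, (∀ v, 0 ≤ w v) → Continuous w →
      ∀ ⦃Hf sf : ℝ → ℝ → ℝ⦄, (∀ m v, 2 < m → Hf m v = w v ^ m) →
      (∀ m, 2 < m → ContDiff ℝ 2 (Hf m) ∧ Hf m 0 = 0 ∧ (∀ v, 0 ≤ deriv (deriv (Hf m)) v) ∧
        (∀ v, deriv (Hf m) v ^ 2 ≤ m / (m - 1) * (Hf m v * deriv (deriv (Hf m)) v)) ∧
        ContDiff ℝ 1 (sf m) ∧ (∀ v, sf m v ^ 2 = Hf m v) ∧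
        (∀ v, 2 * deriv (sf m) v ^ 2 ≤ deriv (deriv (Hf m)) v)) →
      eLpNorm (fun p : ℝ × EuclideanSpace ℝ (Fin 3) => w (F p.1 p.2)) ∞
          (((volume : Measure ℝ).prod (volume : Measure (EuclideanSpace ℝ (Fin 3)))).restrict
            (Ioc (-(ρ / 2) ^ 2) 0 ×ˢ {x : EuclideanSpace ℝ (Fin 3) | x 2 ∈ Icc 0 P ∧ cylRadius x ≤ ρ / 2})) ≤
        ENNReal.ofReal (Cmv * (1 + CΦ ^ 2) ^ (5 / 8 : ℝ) * (1 + ρ / P) ^ (1 / 4 : ℝ) * ρ ^ (-(5 / 4 : ℝ))) *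
          eLpNorm (fun p : ℝ × EuclideanSpace ℝ (Fin 3) => w (F p.1 p.2)) (ENNReal.ofReal 4)
            (((volume : Measure ℝ).prod (volume : Measure (EuclideanSpace ℝ (Fin 3)))).restrict
              (Ioc (-ρ ^ 2) 0 ×ˢ {x : EuclideanSpace ℝ (Fin 3) | x 2 ∈ Icc 0 P ∧ cylRadius x ≤ ρ})) := by
  -- the absolute constants
  obtain ⟨Cφ, hCφ0, hCφ⟩ := exists_norm_gradient_cylCutoff_le
  obtain ⟨CT, hCT0, hCT⟩ := exists_abs_deriv_smoothTransition_le
  obtain ⟨C₀, hC₀pos, hSob⟩ := exists_lintegral_rpow_tenThirds_slab_le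
  set CS : ℝ := (SNormLESNormFDerivOfEqConst ℝ (volume : Measure (EuclideanSpace ℝ (Fin 3))) 2 : ℝ) with hCS
  -- `a₁ ≤ (1 + C_Φ²) a₁'` etc.: we bound the chain constant by `(1 + C_Φ²)^{5/3} c`
  set a₁' : ℝ := 72 * Cφ ^ 2 + 3 * CT with ha₁'
  have ha₁'0 : 0 ≤ a₁' := by rw [ha₁']; positivity
  set a₂' : ℝ := 2 * a₁' + 18 * Cφ ^ 2 + C₀ ^ 2 with ha₂'
  have ha₂'0 : 0 ≤ a₂' := by rw [ha₂']; positivity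
  set c : ℝ := 6 * CS ^ 2 * a₁' ^ (2 / 3 : ℝ) * a₂' with hc
  have hc0 : 0 ≤ c := by rw [hc]; positivity
  set c' : ℝ := c + 1 with hc'
  have hc'0 : 0 < c' := by positivity
  refine ⟨c' ^ (3 / 8 : ℝ) * (9 : ℝ) ^ (15 / 16 : ℝ), by positivity, ?_⟩
  intro P hP ρ hρ F N b Φ CΦ hF2 hFa hF0 hFp hb1 hbdiv hbp hΦ1 hΦp hΦz hCΦ hΦb hN heq hFc hF1c hNm hNi
    w hw0 hwc Hf sf hHw hfam
  -- the number of periods of the Sobolev window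
  set Mw : ℕ := ⌈ρ / P⌉₊ with hMw
  have hMw1 : 1 ≤ Mw := Nat.one_le_iff_ne_zero.2 (Nat.pos_iff_ne_zero.1 (Nat.ceil_pos.2 (by positivity)))
  have hMr0 : (0 : ℝ) < Mw := by exact_mod_cast hMw1
  have hMr1 : ρ ≤ (Mw : ℝ) * P := by
    have h := Nat.le_ceil (ρ / P)
    rw [← hMw] at h
    calc ρ = ρ / P * P := by field_simp
      _ ≤ (Mw : ℝ) * P := mul_le_mul_of_nonneg_right h hP.le
  have hMr2 : (Mw : ℝ) ≤ 1 + ρ / P := by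
    have h := (Nat.ceil_lt_add_one (by positivity : 0 ≤ ρ / P)).le
    rw [← hMw] at h
    linarith
  have hSobP := hSob hP hMw1
  -- the chain constants
  set Λ : ℝ := 1 + CΦ ^ 2 with hΛ
  have hΛ1 : 1 ≤ Λ := by rw [hΛ]; nlinarith [sq_nonneg CΦ]
  have hΛ0 : 0 < Λ := by linarith
  set C₀r : ℝ := (c' * Λ ^ (5 / 3 : ℝ) * (1 + ρ / P) ^ (2 / 3 : ℝ) * ρ ^ (-(10 / 3 : ℝ))) ^ (3 / 5 : ℝ)
    with hC₀r
  have hρP : 0 < 1 + ρ / P := by positivity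
  have hC₀r0 : 0 < C₀r := by positivity
  set C₀n : ℝ≥0 := Real.toNNReal C₀r with hC₀n
  have hC₀ne : C₀n ≠ 0 := fun h => (not_le.2 hC₀r0) (Real.toNNReal_eq_zero.1 h)
  have hC₀e : ((C₀n : ℝ≥0∞)) = ENNReal.ofReal C₀r := rfl
  have hu : AEStronglyMeasurable (fun p : ℝ × EuclideanSpace ℝ (Fin 3) => w (F p.1 p.2))
      ((volume : Measure ℝ).prod (volume : Measure (EuclideanSpace ℝ (Fin 3)))) :=
    (hwc.comp hFc).aestronglyMeasurable
  have hchain := eLpNorm_top_periodCylinder_le_of_reverse_holder (P := P) hu (fun p => hw0 _) hρ hC₀ne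
    (b := 9) (by norm_num) ?_
  · refine hchain.trans (le_of_eq ?_)
    congr 1
    rw [hC₀e, ENNReal.ofReal_rpow_of_nonneg hC₀r0.le (by norm_num),
      show ((9 : ℝ≥0) : ℝ≥0∞) = ENNReal.ofReal 9 by norm_num,
      ENNReal.ofReal_rpow_of_nonneg (by norm_num) (by norm_num), ← ENNReal.ofReal_mul (by positivity)]
    congr 1
    rw [hC₀r, ← Real.rpow_mul (by positivity), Real.mul_rpow (by positivity) (Real.rpow_nonneg hρ.le _),
      Real.mul_rpow (by positivity) (Real.rpow_nonneg hρP.le _),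
      Real.mul_rpow hc'0.le (Real.rpow_nonneg hΛ0.le _),
      ← Real.rpow_mul hρ.le, ← Real.rpow_mul hρP.le, ← Real.rpow_mul hΛ0.le]
    norm_num
    ring
  -- ### the reverse Hölder inequality at level `k`
  intro k
  obtain ⟨hrk0, hrklo, hrkhi⟩ := moser_radius_bounds hρ k
  obtain ⟨hrk10, hrk1lo, hrk1hi⟩ := moser_radius_bounds hρ (k + 1)
  set r₁ : ℝ := ρ / 2 * (1 + (1 / 3 : ℝ) ^ k) with hr₁
  set r₂ : ℝ := ρ / 2 * (1 + (1 / 3 : ℝ) ^ (k + 1)) with hr₂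
  have hr : r₂ < r₁ := by
    rw [hr₁, hr₂, pow_succ]
    have : 0 < (1 / 3 : ℝ) ^ k := by positivity
    nlinarith
  -- the exponent `m = 4 (5/3)^k > 2`
  set m : ℝ := 4 * (5 / 3 : ℝ) ^ k with hm
  have hmk : (1 : ℝ) ≤ (5 / 3 : ℝ) ^ k := one_le_pow₀ (by norm_num)
  have hm2 : 2 < m := by rw [hm]; nlinarith
  obtain ⟨hH, hH00, hH2, hκ', hsH, hsH2, hsH'⟩ := hfam m hm2
  have hH0 : ∀ v, 0 ≤ Hf m v := fun v => by rw [hHw m v hm2]; exact Real.rpow_nonneg (hw0 v) _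
  set κ : ℝ := m / (m - 1) with hκdef
  have hm1 : 0 < m - 1 := by linarith
  have hκ1 : 1 ≤ κ := by rw [hκdef, le_div_iff₀ hm1]; linarith
  have hκ2 : κ ≤ 2 := by rw [hκdef, div_le_iff₀ hm1]; linarith
  have hκ : ∀ v, deriv (Hf m) v ^ 2 ≤ κ * Hf m v * deriv (deriv (Hf m)) v := fun v => by
    rw [mul_assoc]; exact hκ' v
  have hlev := reverse_holder_between_periodCylinders hP (Mw := Mw) (C₀ := C₀) hSobP hF2 hFa hF0 hFp
    hb1 hbdiv hbp hΦ1 hΦp hΦz hCΦ hΦb hN heq hFc hF1c hNm hNi hH hH00 hH0 hH2 hκ1 hκ hsH hsH2 hsH'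
    hCφ hCT hrk10 hr hrkhi
  -- rewrite the integrands as powers of `u = w(F)`
  have hexp1 : ∀ p : ℝ × EuclideanSpace ℝ (Fin 3),
      ENNReal.ofReal (Hf m (F p.1 p.2)) ^ (5 / 3 : ℝ) =
        ENNReal.ofReal (w (F p.1 p.2)) ^ (4 * (5 / 3 : ℝ) ^ (k + 1)) := by
    intro p
    rw [hHw m _ hm2, ← ENNReal.ofReal_rpow_of_nonneg (hw0 _) (by rw [hm]; positivity),
      ← ENNReal.rpow_mul, hm, pow_succ]
    congr 1; ring
  have hexp2 : ∀ p : ℝ × EuclideanSpace ℝ (Fin 3),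
      ENNReal.ofReal (Hf m (F p.1 p.2)) = ENNReal.ofReal (w (F p.1 p.2)) ^ (4 * (5 / 3 : ℝ) ^ k) := by
    intro p
    rw [hHw m _ hm2, ← ENNReal.ofReal_rpow_of_nonneg (hw0 _) (by rw [hm]; positivity), hm]
  simp_rw [hexp1, hexp2] at hlev
  refine hlev.trans (mul_le_mul' ?_ le_rfl)
  -- ### the constant: `K_k ≤ (C₀ 9^k)^{5/3}`
  have harith := moser_level_constant_le_periodic k hρ hP (CS := CS) (Cφ := Cφ) (CT := CT) (CΦ := CΦ)
    (C₀ := C₀) hCT0.le (zero_le_one.trans hκ1) hκ2 hMr1 hMr2 hMr0 hr₁ hr₂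
  -- compare `a₁, a₂` of the lemma with `Λ a₁', Λ a₂'`
  have ha₁cmp : 72 * (1 + CΦ ^ 2) * Cφ ^ 2 + 3 * CT ≤ Λ * a₁' := by
    have e : Λ * a₁' = (72 * (1 + CΦ ^ 2) * Cφ ^ 2 + 3 * CT) + 3 * CT * CΦ ^ 2 := by
      simp only [hΛ, ha₁']; ring
    rw [e]
    have : 0 ≤ 3 * CT * CΦ ^ 2 := by positivity
    linarith
  have ha₁0 : 0 ≤ 72 * (1 + CΦ ^ 2) * Cφ ^ 2 + 3 * CT := by positivity
  have ha₂cmp : 2 * (72 * (1 + CΦ ^ 2) * Cφ ^ 2 + 3 * CT) + 18 * Cφ ^ 2 + C₀ ^ 2 ≤ Λ * a₂' := by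
    have e : Λ * a₂' = 2 * (Λ * a₁') + Λ * (18 * Cφ ^ 2 + C₀ ^ 2) := by
      simp only [ha₂']; ring
    have h1 : 18 * Cφ ^ 2 + C₀ ^ 2 ≤ Λ * (18 * Cφ ^ 2 + C₀ ^ 2) :=
      le_mul_of_one_le_left (by positivity) hΛ1
    rw [e]
    linarith [ha₁cmp]
  have hconst_le : 6 * CS ^ 2 * (72 * (1 + CΦ ^ 2) * Cφ ^ 2 + 3 * CT) ^ (2 / 3 : ℝ) *
      (2 * (72 * (1 + CΦ ^ 2) * Cφ ^ 2 + 3 * CT) + 18 * Cφ ^ 2 + C₀ ^ 2) ≤ c * Λ ^ (5 / 3 : ℝ) := by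
    have h1 : (72 * (1 + CΦ ^ 2) * Cφ ^ 2 + 3 * CT) ^ (2 / 3 : ℝ) ≤ Λ ^ (2 / 3 : ℝ) * a₁' ^ (2 / 3 : ℝ) := by
      rw [← Real.mul_rpow hΛ0.le ha₁'0]
      exact Real.rpow_le_rpow ha₁0 ha₁cmp (by norm_num)
    have hΛ53 : Λ ^ (5 / 3 : ℝ) = Λ ^ (2 / 3 : ℝ) * Λ := by
      rw [show (5 / 3 : ℝ) = 2 / 3 + 1 by norm_num, Real.rpow_add hΛ0, Real.rpow_one]
    calc 6 * CS ^ 2 * (72 * (1 + CΦ ^ 2) * Cφ ^ 2 + 3 * CT) ^ (2 / 3 : ℝ) *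
          (2 * (72 * (1 + CΦ ^ 2) * Cφ ^ 2 + 3 * CT) + 18 * Cφ ^ 2 + C₀ ^ 2)
        ≤ 6 * CS ^ 2 * (Λ ^ (2 / 3 : ℝ) * a₁' ^ (2 / 3 : ℝ)) * (Λ * a₂') := by
          refine mul_le_mul (mul_le_mul_of_nonneg_left h1 (by positivity)) ha₂cmp (by positivity) ?_
          exact mul_nonneg (by positivity) (mul_nonneg (Real.rpow_nonneg hΛ0.le _) (Real.rpow_nonneg ha₁'0 _))
      _ = c * Λ ^ (5 / 3 : ℝ) := by rw [hΛ53]; simp only [hc]; ring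
  have hrhs : (((C₀n : ℝ≥0∞) * ((9 : ℝ≥0) : ℝ≥0∞) ^ k) ^ (5 / 3 : ℝ)) =
      ENNReal.ofReal (c' * Λ ^ (5 / 3 : ℝ) * (1 + ρ / P) ^ (2 / 3 : ℝ) * ρ ^ (-(10 / 3 : ℝ)) *
        (9 : ℝ) ^ ((5 / 3 : ℝ) * k)) := by
    have h9k : ((9 : ℝ≥0) : ℝ≥0∞) ^ k = ENNReal.ofReal ((9 : ℝ) ^ k) := by
      rw [ENNReal.ofReal_pow (by norm_num)]; norm_num
    have key : (C₀r * (9 : ℝ) ^ k) ^ (5 / 3 : ℝ) =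
        c' * Λ ^ (5 / 3 : ℝ) * (1 + ρ / P) ^ (2 / 3 : ℝ) * ρ ^ (-(10 / 3 : ℝ)) * (9 : ℝ) ^ ((5 / 3 : ℝ) * k) := by
      rw [Real.mul_rpow hC₀r0.le (by positivity), hC₀r, ← Real.rpow_mul (by positivity),
        ← Real.rpow_natCast (9 : ℝ) k, ← Real.rpow_mul (by norm_num),
        show (3 / 5 : ℝ) * (5 / 3) = 1 by norm_num, Real.rpow_one, mul_comm (k : ℝ)]
    rw [hC₀e, h9k, ← ENNReal.ofReal_mul hC₀r0.le,
      ENNReal.ofReal_rpow_of_nonneg (by positivity) (by norm_num), key]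
  rw [hrhs]
  refine ENNReal.ofReal_le_ofReal (harith.trans ?_)
  have hpos : 0 ≤ (1 + ρ / P) ^ (2 / 3 : ℝ) * ρ ^ (-(10 / 3 : ℝ)) * (9 : ℝ) ^ ((5 / 3 : ℝ) * k) := by positivity
  calc 6 * CS ^ 2 * (72 * (1 + CΦ ^ 2) * Cφ ^ 2 + 3 * CT) ^ (2 / 3 : ℝ) *
        (2 * (72 * (1 + CΦ ^ 2) * Cφ ^ 2 + 3 * CT) + 18 * Cφ ^ 2 + C₀ ^ 2) *
        (1 + ρ / P) ^ (2 / 3 : ℝ) * ρ ^ (-(10 / 3 : ℝ)) * (9 : ℝ) ^ ((5 / 3 : ℝ) * k)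
      = (6 * CS ^ 2 * (72 * (1 + CΦ ^ 2) * Cφ ^ 2 + 3 * CT) ^ (2 / 3 : ℝ) *
          (2 * (72 * (1 + CΦ ^ 2) * Cφ ^ 2 + 3 * CT) + 18 * Cφ ^ 2 + C₀ ^ 2)) *
          ((1 + ρ / P) ^ (2 / 3 : ℝ) * ρ ^ (-(10 / 3 : ℝ)) * (9 : ℝ) ^ ((5 / 3 : ℝ) * k)) := by ring
    _ ≤ (c * Λ ^ (5 / 3 : ℝ)) * ((1 + ρ / P) ^ (2 / 3 : ℝ) * ρ ^ (-(10 / 3 : ℝ)) * (9 : ℝ) ^ ((5 / 3 : ℝ) * k)) :=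
        mul_le_mul_of_nonneg_right hconst_le hpos
    _ ≤ (c' * Λ ^ (5 / 3 : ℝ)) * ((1 + ρ / P) ^ (2 / 3 : ℝ) * ρ ^ (-(10 / 3 : ℝ)) * (9 : ℝ) ^ ((5 / 3 : ℝ) * k)) := by
        refine mul_le_mul_of_nonneg_right ?_ hpos
        exact mul_le_mul_of_nonneg_right (by linarith) (Real.rpow_nonneg hΛ0.le _)
    _ = _ := by ring

end LeiRenZhang2019

end Literature.Analysis.FluidPDE

end
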